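import Summits.AtomisticToContinuum.BoseEinsteinCondensation.Theorems.BECHeatBathGapJastrowDobrushinRungHeatBath

/-!
# Route `BECHeatBathGap` — support item `JastrowDobrushinRung` (stmt-AtomisticToContinuum-14373):
# symmetry and Pythagoras for the heat-bath operator (helper file 2)

Helpers for the proof of
`Summit.AtomisticToContinuum.BoseEinsteinCondensation.Theses.BECHeatBathGap.JastrowDobrushinRung`
(approximate tensorisation of variance with constant 2 for the Jastrow law under
`5N∫(1-f²) ≤ L³`, via Dobrushin uniqueness ⇒ heat-bath spectral gap ≥ 1 - r, Wu 2006, re-proved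
from scratch). As in helper file 1, the operators `S` (one-site average), `T` (heat bath),
`P = N⁻¹∑T_j` (random-scan Gibbs sampler) and the weights `w = B_j π_j` are variables with
defining hypotheses `hS, hT, hP, hw, …` (no auxiliary definitions).

This file: measurability/integrability of the weight, the fibre identity `S_mul_T_mul_w`, the
symmetry `∫ H (T_j F) w = ∫ (T_j H) F w` (`T_symm`), mean preservation, `⟨T_jF,T_jF⟩ = ⟨F,T_jF⟩`,
and the Pythagoras identity `∫(F-g)²w = ∫(F-T_jF)²w + ∫(T_jF-g)²w` for `g` not depending on
`x_j` (`integral_sub_sq_mul_w_eq`), whence `T_j F` is the best such predictor.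
-/

noncomputable section

namespace Summit.AtomisticToContinuum.BoseEinsteinCondensation.Theorems

namespace JastrowDobrushin

open MeasureTheory Function
open scoped ENNReal

variable {ι : Type*} [DecidableEq ι] {E : Type*} [MeasurableSpace E]
  {u : Measure E} {S : ι → ((ι → E) → ℝ) → (ι → E) → ℝ}
variable {π : ι → (ι → E) → ℝ} {T : ι → ((ι → E) → ℝ) → (ι → E) → ℝ}

/-! ### Symmetry of the heat-bath operator in `L²(w du^{⊗ι})` -/

variable {w : (ι → E) → ℝ} {B : ι → (ι → E) → ℝ}

/-- The weight `w = B_j π_j` is measurable. [folklore] -/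
theorem measurable_w (hπ : ∀ j, Measurable (π j) ∧ ∀ X, 0 ≤ π j X ∧ π j X ≤ 1)
    (hw : ∀ j X, w X = B j X * π j X)
    (hB : ∀ j, Measurable (B j) ∧ (∀ X, 0 ≤ B j X ∧ B j X ≤ 1) ∧ ∀ X y, B j (update X j y) = B j X)
    (j : ι) : Measurable w := by
  have h : w = fun X => B j X * π j X := funext (hw j)
  rw [h]
  exact (hB j).1.mul (hπ j).1

/-- The weight `w = B_j π_j` takes values in `[0, 1]`. [folklore] -/
theorem w_mem (hπ : ∀ j, Measurable (π j) ∧ ∀ X, 0 ≤ π j X ∧ π j X ≤ 1)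
    (hw : ∀ j X, w X = B j X * π j X)
    (hB : ∀ j, Measurable (B j) ∧ (∀ X, 0 ≤ B j X ∧ B j X ≤ 1) ∧ ∀ X y, B j (update X j y) = B j X)
    (j : ι) (X : ι → E) : 0 ≤ w X ∧ w X ≤ 1 := by
  rw [hw j]
  exact ⟨mul_nonneg ((hB j).2.1 X).1 ((hπ j).2 X).1,
    mul_le_one₀ ((hB j).2.1 X).2 ((hπ j).2 X).1 ((hπ j).2 X).2⟩

/-- A bounded measurable function times a weight in `[0,1]` is integrable against a finite
measure. [folklore] -/
theorem integrable_mul_w {α : Type*} [MeasurableSpace α] {μ : Measure α} [IsFiniteMeasure μ]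
    {Φ v : α → ℝ} (hΦm : Measurable Φ) {C : ℝ} (hΦb : ∀ X, |Φ X| ≤ C) (hwm : Measurable v)
    (hw1 : ∀ X, 0 ≤ v X ∧ v X ≤ 1) : Integrable (fun X => Φ X * v X) μ :=
  integrable_of_bounded (hΦm.mul hwm) (C := C) fun X => by
    rw [abs_mul, abs_of_nonneg (hw1 X).1]
    exact (mul_le_mul_of_nonneg_left (hw1 X).2 (abs_nonneg _)).trans
      (by rw [mul_one]; exact hΦb X)

/-- The fibre integral of `H · T_j F · w`: a symmetric expression in `F` and `H`. [folklore] -/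
theorem S_mul_T_mul_w (hS : ∀ j G X, S j G X = ∫ y, G (update X j y) ∂u)
    (hT : ∀ j F X, T j F X = S j (fun Y => F Y * π j Y) X / S j (π j) X)
    (hw : ∀ j X, w X = B j X * π j X)
    (hB : ∀ j, Measurable (B j) ∧ (∀ X, 0 ≤ B j X ∧ B j X ≤ 1) ∧ ∀ X y, B j (update X j y) = B j X)
    (j : ι) (F H : (ι → E) → ℝ) (X : ι → E) :
    S j (fun Y => H Y * T j F Y * w Y) X =
      B j X * (S j (fun Y => H Y * π j Y) X * S j (fun Y => F Y * π j Y) X) / S j (π j) X := by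
  have h1 : S j (fun Y => H Y * T j F Y * w Y) X =
      S j (fun Y => (T j F X * B j X) * (H Y * π j Y)) X := by
    refine S_congr hS fun y => ?_
    simp only [T_update hS hT, hw j, (hB j).2.2]
    ring
  rw [h1, S_smul hS j, hT]
  ring

/-- **Symmetry of the heat-bath operator**: `∫ H (T_j F) w = ∫ (T_j H) F w` for bounded measurable
`F, H` (the operator `T_j` is the orthogonal projection of `L²(w du^{⊗ι})` onto the functions not
depending on `x_j`). [folklore] -/
theorem T_symm [Fintype ι] [IsProbabilityMeasure u]
    (hS : ∀ j G X, S j G X = ∫ y, G (update X j y) ∂u)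
    (hT : ∀ j F X, T j F X = S j (fun Y => F Y * π j Y) X / S j (π j) X)
    (hπ : ∀ j, Measurable (π j) ∧ ∀ X, 0 ≤ π j X ∧ π j X ≤ 1) (hZ : ∀ j X, 0 < S j (π j) X)
    (hw : ∀ j X, w X = B j X * π j X)
    (hB : ∀ j, Measurable (B j) ∧ (∀ X, 0 ≤ B j X ∧ B j X ≤ 1) ∧ ∀ X y, B j (update X j y) = B j X)
    (j : ι) {F H : (ι → E) → ℝ} (hFm : Measurable F) (hHm : Measurable H) {C C' : ℝ}
    (hFb : ∀ X, |F X| ≤ C) (hHb : ∀ X, |H X| ≤ C') :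
    ∫ X, H X * T j F X * w X ∂(Measure.pi fun _ : ι => u) =
      ∫ X, T j H X * F X * w X ∂(Measure.pi fun _ : ι => u) := by
  have hwm := measurable_w hπ hw hB j
  have hw1 := w_mem hπ hw hB j
  have hTF := measurable_T hS hT hπ j hFm
  have hTH := measurable_T hS hT hπ j hHm
  have hint1 : Integrable (fun X => H X * T j F X * w X) (Measure.pi fun _ : ι => u) :=
    integrable_mul_w (hHm.mul hTF) (C := C' * C) (fun X => by
      rw [abs_mul]
      exact mul_le_mul (hHb X) (abs_T_le hS hT hπ hZ j hFm hFb X) (abs_nonneg _)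
        ((abs_nonneg _).trans (hHb X))) hwm hw1
  have hint2 : Integrable (fun X => F X * T j H X * w X) (Measure.pi fun _ : ι => u) :=
    integrable_mul_w (hFm.mul hTH) (C := C * C') (fun X => by
      rw [abs_mul]
      exact mul_le_mul (hFb X) (abs_T_le hS hT hπ hZ j hHm hHb X) (abs_nonneg _)
        ((abs_nonneg _).trans (hFb X))) hwm hw1
  have e1 := integral_eq_integral_integral_update j hint1
  have e2 := integral_eq_integral_integral_update j hint2
  have h2 : (fun X => T j H X * F X * w X) = fun X => F X * T j H X * w X := by
    funext X; ring
  rw [h2, e1, e2]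
  refine integral_congr_ae (ae_of_all _ fun X => ?_)
  simp only
  rw [← hS j (fun Y => H Y * T j F Y * w Y) X, ← hS j (fun Y => F Y * T j H Y * w Y) X,
    S_mul_T_mul_w hS hT hw hB j F H X, S_mul_T_mul_w hS hT hw hB j H F X]
  ring


/-- `T_j` preserves the `w`-mean: `∫ (T_j F) w = ∫ F w`. [folklore] -/
theorem integral_T_mul_w [Fintype ι] [IsProbabilityMeasure u]
    (hS : ∀ j G X, S j G X = ∫ y, G (update X j y) ∂u)
    (hT : ∀ j F X, T j F X = S j (fun Y => F Y * π j Y) X / S j (π j) X)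
    (hπ : ∀ j, Measurable (π j) ∧ ∀ X, 0 ≤ π j X ∧ π j X ≤ 1) (hZ : ∀ j X, 0 < S j (π j) X)
    (hw : ∀ j X, w X = B j X * π j X)
    (hB : ∀ j, Measurable (B j) ∧ (∀ X, 0 ≤ B j X ∧ B j X ≤ 1) ∧ ∀ X y, B j (update X j y) = B j X)
    (j : ι) {F : (ι → E) → ℝ} (hFm : Measurable F) {C : ℝ} (hFb : ∀ X, |F X| ≤ C) :
    ∫ X, T j F X * w X ∂(Measure.pi fun _ : ι => u) =
      ∫ X, F X * w X ∂(Measure.pi fun _ : ι => u) := by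
  have h := T_symm hS hT hπ hZ hw hB j hFm measurable_const hFb (H := fun _ => (1 : ℝ))
    (C' := 1) (fun _ => by simp)
  have h1 : (T j fun _ => (1 : ℝ)) = fun _ => 1 := funext fun X => T_const hS hT hZ j 1 X
  simpa only [h1, one_mul] using h

/-- `⟨T_j F, T_j F⟩_w = ⟨F, T_j F⟩_w` (idempotence and symmetry). [folklore] -/
theorem integral_T_mul_T_mul_w [Fintype ι] [IsProbabilityMeasure u]
    (hS : ∀ j G X, S j G X = ∫ y, G (update X j y) ∂u)
    (hT : ∀ j F X, T j F X = S j (fun Y => F Y * π j Y) X / S j (π j) X)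
    (hπ : ∀ j, Measurable (π j) ∧ ∀ X, 0 ≤ π j X ∧ π j X ≤ 1) (hZ : ∀ j X, 0 < S j (π j) X)
    (hw : ∀ j X, w X = B j X * π j X)
    (hB : ∀ j, Measurable (B j) ∧ (∀ X, 0 ≤ B j X ∧ B j X ≤ 1) ∧ ∀ X y, B j (update X j y) = B j X)
    (j : ι) {F : (ι → E) → ℝ} (hFm : Measurable F) {C : ℝ} (hFb : ∀ X, |F X| ≤ C) :
    ∫ X, T j F X * T j F X * w X ∂(Measure.pi fun _ : ι => u) =
      ∫ X, F X * T j F X * w X ∂(Measure.pi fun _ : ι => u) := by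
  have h := T_symm hS hT hπ hZ hw hB j hFm (measurable_T hS hT hπ j hFm) hFb
    (H := T j F) (C' := C) (abs_T_le hS hT hπ hZ j hFm hFb)
  have h1 : T j (T j F) = T j F := funext fun X => T_fix hS hT hZ j (T_update hS hT j F X)
  rw [h1] at h
  rw [h]
  refine integral_congr_ae (ae_of_all _ fun X => ?_)
  simp only
  ring

/-- `0 ≤ ⟨F, T_j F⟩_w`. [folklore] -/
theorem integral_mul_T_mul_w_nonneg [Fintype ι] [IsProbabilityMeasure u]
    (hS : ∀ j G X, S j G X = ∫ y, G (update X j y) ∂u)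
    (hT : ∀ j F X, T j F X = S j (fun Y => F Y * π j Y) X / S j (π j) X)
    (hπ : ∀ j, Measurable (π j) ∧ ∀ X, 0 ≤ π j X ∧ π j X ≤ 1) (hZ : ∀ j X, 0 < S j (π j) X)
    (hw : ∀ j X, w X = B j X * π j X)
    (hB : ∀ j, Measurable (B j) ∧ (∀ X, 0 ≤ B j X ∧ B j X ≤ 1) ∧ ∀ X y, B j (update X j y) = B j X)
    (j : ι) {F : (ι → E) → ℝ} (hFm : Measurable F) {C : ℝ} (hFb : ∀ X, |F X| ≤ C) :
    0 ≤ ∫ X, F X * T j F X * w X ∂(Measure.pi fun _ : ι => u) := by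
  rw [← integral_T_mul_T_mul_w hS hT hπ hZ hw hB j hFm hFb]
  exact integral_nonneg fun X => mul_nonneg (mul_self_nonneg _) (w_mem hπ hw hB j X).1

/-- For `h` not depending on `x_j`: `∫ h (T_j F) w = ∫ h F w`. [folklore] -/
theorem integral_inv_mul_T_mul_w [Fintype ι] [IsProbabilityMeasure u]
    (hS : ∀ j G X, S j G X = ∫ y, G (update X j y) ∂u)
    (hT : ∀ j F X, T j F X = S j (fun Y => F Y * π j Y) X / S j (π j) X)
    (hπ : ∀ j, Measurable (π j) ∧ ∀ X, 0 ≤ π j X ∧ π j X ≤ 1) (hZ : ∀ j X, 0 < S j (π j) X)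
    (hw : ∀ j X, w X = B j X * π j X)
    (hB : ∀ j, Measurable (B j) ∧ (∀ X, 0 ≤ B j X ∧ B j X ≤ 1) ∧ ∀ X y, B j (update X j y) = B j X)
    (j : ι) {F h : (ι → E) → ℝ} (hFm : Measurable F) (hhm : Measurable h) {C C' : ℝ}
    (hFb : ∀ X, |F X| ≤ C) (hhb : ∀ X, |h X| ≤ C') (hh : ∀ X y, h (update X j y) = h X) :
    ∫ X, h X * T j F X * w X ∂(Measure.pi fun _ : ι => u) =
      ∫ X, h X * F X * w X ∂(Measure.pi fun _ : ι => u) := by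
  rw [T_symm hS hT hπ hZ hw hB j hFm hhm hFb hhb]
  have h1 : T j h = h := funext fun X => T_fix hS hT hZ j (hh X)
  rw [h1]

/-- **Pythagoras for the heat-bath projection**: for `g` bounded measurable and not depending on
`x_j`, `∫ (F - g)² w = ∫ (F - T_j F)² w + ∫ (T_j F - g)² w`; in particular `T_j F` is the best
`x_j`-independent predictor of `F` in `L²(w)`. [folklore] -/
theorem integral_sub_sq_mul_w_eq [Fintype ι] [IsProbabilityMeasure u]
    (hS : ∀ j G X, S j G X = ∫ y, G (update X j y) ∂u)
    (hT : ∀ j F X, T j F X = S j (fun Y => F Y * π j Y) X / S j (π j) X)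
    (hπ : ∀ j, Measurable (π j) ∧ ∀ X, 0 ≤ π j X ∧ π j X ≤ 1) (hZ : ∀ j X, 0 < S j (π j) X)
    (hw : ∀ j X, w X = B j X * π j X)
    (hB : ∀ j, Measurable (B j) ∧ (∀ X, 0 ≤ B j X ∧ B j X ≤ 1) ∧ ∀ X y, B j (update X j y) = B j X)
    (j : ι) {F g : (ι → E) → ℝ} (hFm : Measurable F) (hgm : Measurable g) {C C' : ℝ}
    (hFb : ∀ X, |F X| ≤ C) (hgb : ∀ X, |g X| ≤ C') (hg : ∀ X y, g (update X j y) = g X) :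
    ∫ X, (F X - g X) ^ 2 * w X ∂(Measure.pi fun _ : ι => u) =
      ∫ X, (F X - T j F X) ^ 2 * w X ∂(Measure.pi fun _ : ι => u) +
        ∫ X, (T j F X - g X) ^ 2 * w X ∂(Measure.pi fun _ : ι => u) := by
  have hwm := measurable_w hπ hw hB j
  have hw1 := w_mem hπ hw hB j
  have hTm := measurable_T hS hT hπ j hFm
  have hTb := abs_T_le hS hT hπ hZ j hFm hFb
  -- the `x_j`-independent function `h = T_j F - g`
  have hhm : Measurable fun X => T j F X - g X := hTm.sub hgm
  have hhb : ∀ X, |T j F X - g X| ≤ C + C' := fun X =>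
    (abs_sub _ _).trans (add_le_add (hTb X) (hgb X))
  have hhinv : ∀ X y, T j F (update X j y) - g (update X j y) = T j F X - g X := fun X y => by
    rw [T_update hS hT, hg]
  -- cross term vanishes
  have hcross : ∫ X, (T j F X - g X) * T j F X * w X ∂(Measure.pi fun _ : ι => u) =
      ∫ X, (T j F X - g X) * F X * w X ∂(Measure.pi fun _ : ι => u) :=
    integral_inv_mul_T_mul_w hS hT hπ hZ hw hB j hFm hhm hFb hhb hhinv
  -- pointwise algebra: (F-g)² w = (F-TF)² w + (TF-g)² w + 2 (TF-g) F w - 2 (TF-g) TF w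
  have hpt : ∀ X, (F X - g X) ^ 2 * w X = ((F X - T j F X) ^ 2 * w X +
      (T j F X - g X) ^ 2 * w X) + ((2 : ℝ) * ((T j F X - g X) * F X * w X) -
      (2 : ℝ) * ((T j F X - g X) * T j F X * w X)) := fun X => by ring
  have i1 : Integrable (fun X => (F X - T j F X) ^ 2 * w X) (Measure.pi fun _ : ι => u) :=
    integrable_mul_w ((hFm.sub hTm).pow_const 2) (C := (C + C) ^ 2) (fun X => by
      rw [abs_pow]
      exact pow_le_pow_left₀ (abs_nonneg _) ((abs_sub _ _).trans (add_le_add (hFb X) (hTb X)))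
        2) hwm hw1
  have i2 : Integrable (fun X => (T j F X - g X) ^ 2 * w X) (Measure.pi fun _ : ι => u) :=
    integrable_mul_w (hhm.pow_const 2) (C := (C + C') ^ 2) (fun X => by
      rw [abs_pow]
      exact pow_le_pow_left₀ (abs_nonneg _) (hhb X) 2) hwm hw1
  have i3 : Integrable (fun X => (T j F X - g X) * F X * w X) (Measure.pi fun _ : ι => u) :=
    integrable_mul_w (hhm.mul hFm) (C := (C + C') * C) (fun X => by
      rw [abs_mul]
      exact mul_le_mul (hhb X) (hFb X) (abs_nonneg _)
        ((abs_nonneg _).trans (hhb X))) hwm hw1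
  have i4 : Integrable (fun X => (T j F X - g X) * T j F X * w X) (Measure.pi fun _ : ι => u) :=
    integrable_mul_w (hhm.mul hTm) (C := (C + C') * C) (fun X => by
      rw [abs_mul]
      exact mul_le_mul (hhb X) (hTb X) (abs_nonneg _)
        ((abs_nonneg _).trans (hhb X))) hwm hw1
  have i12 : Integrable (fun X => (F X - T j F X) ^ 2 * w X + (T j F X - g X) ^ 2 * w X)
      (Measure.pi fun _ : ι => u) := i1.add i2
  have i3' : Integrable (fun X => (2 : ℝ) * ((T j F X - g X) * F X * w X))
      (Measure.pi fun _ : ι => u) := i3.const_mul 2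
  have i4' : Integrable (fun X => (2 : ℝ) * ((T j F X - g X) * T j F X * w X))
      (Measure.pi fun _ : ι => u) := i4.const_mul 2
  have i34 : Integrable (fun X => (2 : ℝ) * ((T j F X - g X) * F X * w X) -
      (2 : ℝ) * ((T j F X - g X) * T j F X * w X)) (Measure.pi fun _ : ι => u) := i3'.sub i4'
  simp_rw [hpt]
  rw [integral_add i12 i34, integral_add i1 i2, integral_sub i3' i4', integral_const_mul,
    integral_const_mul, hcross, sub_self, add_zero]

/-- `T_j F` is the best `x_j`-independent predictor: `∫ (F - T_j F)² w ≤ ∫ (F - g)² w`.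
[folklore] -/
theorem integral_sub_T_sq_mul_w_le [Fintype ι] [IsProbabilityMeasure u]
    (hS : ∀ j G X, S j G X = ∫ y, G (update X j y) ∂u)
    (hT : ∀ j F X, T j F X = S j (fun Y => F Y * π j Y) X / S j (π j) X)
    (hπ : ∀ j, Measurable (π j) ∧ ∀ X, 0 ≤ π j X ∧ π j X ≤ 1) (hZ : ∀ j X, 0 < S j (π j) X)
    (hw : ∀ j X, w X = B j X * π j X)
    (hB : ∀ j, Measurable (B j) ∧ (∀ X, 0 ≤ B j X ∧ B j X ≤ 1) ∧ ∀ X y, B j (update X j y) = B j X)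
    (j : ι) {F g : (ι → E) → ℝ} (hFm : Measurable F) (hgm : Measurable g) {C C' : ℝ}
    (hFb : ∀ X, |F X| ≤ C) (hgb : ∀ X, |g X| ≤ C') (hg : ∀ X y, g (update X j y) = g X) :
    ∫ X, (F X - T j F X) ^ 2 * w X ∂(Measure.pi fun _ : ι => u) ≤
      ∫ X, (F X - g X) ^ 2 * w X ∂(Measure.pi fun _ : ι => u) := by
  rw [integral_sub_sq_mul_w_eq hS hT hπ hZ hw hB j hFm hgm hFb hgb hg]
  have hw1 := w_mem hπ hw hB j
  exact le_add_of_nonneg_right (integral_nonneg fun X => mul_nonneg (sq_nonneg _) (hw1 X).1)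

end JastrowDobrushin

end Summit.AtomisticToContinuum.BoseEinsteinCondensation.Theorems
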